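import Summits.QuantumFields.YangMills.Theorems.BalabanUVNodesN15CurvedGluingCubeSandwichDefect
import Summits.QuantumFields.YangMills.Theorems.BalabanUVNodesN15TwoSpacingGluingEntries
import HarnessLib

/-!
# Route «BalabanUVNodes» (cluster K4 «SpineRates»), Track-A DAG node N15 = NE2, BACKGROUND LAYER — THE SMOOTH-CUT FLAT CUBE: from an UNLOCALIZED cube operator `N_□` known only through its
# CUT rows `M_{χ_□}∘N_□`, `M_{χ_□}∘∇^±_μ∘N_□` (dag-n15-c FILE 63's currency, dag-n15-a's Neumann cubes) and a SMOOTH cut-off `χ̃ ≺ χ_□`, the flat-cube data file 23's dressing wants —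
# `G₀ := M_{χ̃}∘N_□` with derived pieces `∇^±_μ∘G₀` (EXACT jet relation), two-sided letters, cut-offs, two-grid defects; `hloc` modulo the nonlocal tail is file 22's

Cell `pub-ymgap`, seat `pub-ymgap-dag-n15-w3` (WIDTH SEAT 3∕3 on node N15, director-ym №197 ∕ HUMAN RULING D-0149; plan `W-SEAT-START-LIST.md` §n15 item 3 «LG-vector + background layers at
GENERAL small-field U» — thirty-first piece: the adapter between dag-n15-c's cut-row knit (FILES 63∕66–69) and this lineage's dressed cube (files 23–30)).  `bears_on: R4∕N15 · K3⁷
SpineGivenEndpointR13SepCoPH (stmt-QuantumFields-20544)`.  Filed `--kind proof --supports stmt-QuantumFields-20544 --as helper` — COUNT-NEUTRAL.  Theorems only; 0 `sorry`.  Imports BY NAME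
file 22 `…N15CurvedGluingCubeSandwichDefect` (`mulOp_eq_id_sub`, `mulOp_comp_comp_sandwich_of_hloc`; FILE 46 `hasMaj_mulOp_comp_loc`, FILE 45 `hasMaj_diag_comp`∕`mulOp_comp_mulOp`) and dag-n15-c
FILE 48 `…N15TwoSpacingGluingEntries` (`fgrad_comp_mulOp`, `bgrad_comp_mulOp`); lit `hasMaj_mulOp`, `hasMaj_idef_mulOp`, `idef_comp`∕`idef_add`; nothing in the tree is modified.

WHY.  dag-n15-a's cube propagator at `U ≡ 1` is the symmetric extension `N_□ = Sym∘G∘M_{χ°}`; its letters exist only for the CUT objects `M_{χ_□}N_□`, `M_{χ_□}∇_μN_□` (FILE 63: «a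
sharp cut-off cannot be differentiated»).  File 23's dressing wants a flat piece `G₀` with a jet `D_j = ∇_j∘G₀` EXACTLY (`hDq`), two-sided letters of `G₀, D_j`, cut-offs `M_χG₀ = G₀ =
G₀M_ψ`, and `hloc` modulo a defect.  A SMOOTH cut-off `χ̃` (`|χ̃| ≤ 1`, `|∇^±χ̃| ≤ c̃` uniformly — e.g. FILES 59–61's bumps varying over `m₀` blocks; `χ̃`, its one-step translates and
its quotients supported in `{χ_□ = 1}`) delivers all of it for `G₀ := M_{χ̃}∘N_□`: the Leibniz rule `∇⁺∘M_{χ̃} = M_{χ̃∘e}∘∇⁺ + M_{∇⁺χ̃}` (FILE 48) gives `∇⁺∘G₀ = M_{χ̃∘e}(M_χ∇⁺N) +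
M_{∇⁺χ̃}(M_χN)` — cut rows behind BOUNDED smooth multipliers, no jump term; letters `β̃ = β`, `β̃₁ = β₁ + c̃β` two-sided over `S`; the two-grid defects are the cut rows' defects plus
the fits of `χ̃`; and `hloc` for `G₀` modulo the nonlocal tail `−M_hN_LM_{1−χ̃}N_□` is file 22 `mulOp_comp_comp_sandwich_of_hloc` BY NAME (the local part cannot cross the margin,
`M_hΔ_locM_{1−χ̃} = 0`).  So dag-n15-c's live-background knit reads files 23–30 at `G₀ := M_{χ̃}N_□` with every hypothesis discharged from FILE 63's inputs + the bump's letters.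

* §1 `mulOp_comp_mulOp_of_mul_eq` (support insertion `M_a = M_a∘M_χ` from `a·χ = a`), ★ `fgrad_comp_smoothCut` ∕ `bgrad_comp_smoothCut` (`∇^±∘(M_{χ̃}N) = M_{χ̃∘e^{±1}}(M_χ∇^±N) + M_{∇^±χ̃}(M_χN)`,
  cut inserted), `mulOp_comp_smoothCut` (`M_χ̃N = M_χ̃(M_χN)`), cut-offs `smoothCut_out`, `fgrad_smoothCut_out` ∕ `bgrad_smoothCut_out`, `smoothCut_in`;
* §2 ★★ `hasMaj_smoothCut` (`G₀ ≤ 1_S1_S·βe^{−δd}`), ★★ `hasMaj_fgrad_smoothCut` ∕ `hasMaj_bgrad_smoothCut` (`∇^±G₀ ≤ 1_S1_S·(β₁ + c̃β)e^{−δd}`);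
* §3 ★★ `hasMaj_idef_smoothCut` (`𝔇(G₀′, G₀) ≤ 1_S1_S·(m₀ + o_χβ)e^{−δd}`), ★★ `hasMaj_idef_fgrad_smoothCut` ∕ `hasMaj_idef_bgrad_smoothCut` (`𝔇(∇′G₀′, ∇G₀) ≤ 1_S1_S·(m₁ + o₁β₁ + c̃m₀ + o₂β)e^{−δd}`).

HONEST FRAMING ∕ LIMITS.  Finite-dimensional multiplier algebra + block-majorant bookkeeping over DISPLAYED cut rows and bump letters; the bump `χ̃` itself is NOT constructed here (FILES
59–61 ∕ the knit supply it); nothing of [B6]∕[B9] asserted ((2.36)–(2.38) p.229, (2.133) p.247, (3.63)–(3.65) pp.402–403 = SHAPES ∕ MECHANISM).  NE2⁺ NOT PRINTED, NOT proved; N15 NOT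
discharged; counts of record UNMOVED (typed 28∕28 · discharged 5∕27); one finite 𝕋⁴ at fixed ε — NOT infinite volume, NOT OS on ℝ⁴, NOT a mass gap, NOT Clay; R4 closes the conditional
finite-𝕋⁴ rung `BalabanLadder.UV` only.  Restate-immune (no Theses import).
-/

set_option autoImplicit false

noncomputable section
open scoped BigOperators
open Finset

namespace Summit.QuantumFields.YangMills.BalabanUVNodes.N15.CurvedSpecies

open Literature.MathematicalPhysics.QuantumFieldTheory.Balaban1983to89
open Literature.MathematicalPhysics.QuantumFieldTheory.Balaban1983to89.B11SectG (BlockNorm HasMaj)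
open Literature.MathematicalPhysics.QuantumFieldTheory.Balaban1983to89.T4EtaRateDefect (idef idef_apply idef_comp idef_add)
open Literature.MathematicalPhysics.QuantumFieldTheory.Balaban1983to89.T4EtaRateCoeffDefect (pull pull_apply diagK diagK_nonneg hasMaj_mulOp hasMaj_idef_mulOp)
open Literature.MathematicalPhysics.QuantumFieldTheory.Balaban1983to89.B6Prop26Gluing (mulOp mulOp_apply ind ind_nonneg)
open Summit.QuantumFields.YangMills.BalabanUVNodes.N15.BackgroundLayer (fgrad bgrad fgrad_apply bgrad_apply)
open Summit.QuantumFields.YangMills.BalabanUVNodes.N15.Gluing (hasMaj_mulOp_comp_loc hasMaj_diag_comp mulOp_comp_mulOp fgrad_comp_mulOp bgrad_comp_mulOp)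

/-! ## §1 Algebra of the smooth cut -/

section Algebra

variable {Y : Type} (n : ℝ) (e : Y ≃ Y) {N : (Y → ℝ) →ₗ[ℝ] (Y → ℝ)} {χ χt : Y → ℝ}

omit n e in
/-- SUPPORT INSERTION: `a·χ = a` pointwise ⟹ `M_a = M_a∘M_χ`. [folklore] -/
theorem mulOp_comp_mulOp_of_mul_eq {a χ : Y → ℝ} (h : ∀ y, a y * χ y = a y) : mulOp a ∘ₗ mulOp χ = mulOp a := by
  rw [mulOp_comp_mulOp]
  exact congrArg mulOp (funext h)

omit n e in
/-- `M_χ̃N = M_χ̃(M_χN)` when `χ̃χ = χ̃`. [folklore] -/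
theorem mulOp_comp_smoothCut (hsub : mulOp χt ∘ₗ mulOp χ = mulOp χt) : mulOp χt ∘ₗ N = mulOp χt ∘ₗ (mulOp χ ∘ₗ N) := by
  rw [← LinearMap.comp_assoc, hsub]

/-- ★ **THE FORWARD DERIVED PIECE OF THE SMOOTH-CUT CUBE, CUT ROWS INSERTED**: `∇⁺_e(M_χ̃N) = M_{χ̃∘e}(M_χ∇⁺_eN) + M_{∇⁺_eχ̃}(M_χN)` when `(χ̃∘e)χ = χ̃∘e` and `(∇⁺χ̃)χ = ∇⁺χ̃` (FILE 48's Leibniz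
rule; no jump term because `χ̃` is differentiated, not `χ`). [cite: Balaban1984PropagatorsII, (2.36)–(2.38) p.229 (smooth partition∕cube functions: shape); Balaban1984PropagatorsI, (1.126)–(1.128) p.38 (Leibniz: mechanism)] -/
theorem fgrad_comp_smoothCut (hs : mulOp (χt ∘ e) ∘ₗ mulOp χ = mulOp (χt ∘ e)) (hd : mulOp (fgrad n e χt) ∘ₗ mulOp χ = mulOp (fgrad n e χt)) :
    fgrad n e ∘ₗ (mulOp χt ∘ₗ N) = mulOp (χt ∘ e) ∘ₗ (mulOp χ ∘ₗ (fgrad n e ∘ₗ N)) + mulOp (fgrad n e χt) ∘ₗ (mulOp χ ∘ₗ N) := by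
  have hsN : mulOp (χt ∘ e) ∘ₗ (mulOp χ ∘ₗ (fgrad n e ∘ₗ N)) = mulOp (χt ∘ e) ∘ₗ (fgrad n e ∘ₗ N) := by rw [← LinearMap.comp_assoc, hs]
  have hdN : mulOp (fgrad n e χt) ∘ₗ (mulOp χ ∘ₗ N) = mulOp (fgrad n e χt) ∘ₗ N := by rw [← LinearMap.comp_assoc, hd]
  rw [hsN, hdN, ← LinearMap.comp_assoc, fgrad_comp_mulOp, LinearMap.add_comp, LinearMap.comp_assoc]

/-- ★ THE BACKWARD TWIN: `∇⁻_e(M_χ̃N) = M_{χ̃∘e⁻¹}(M_χ∇⁻_eN) + M_{∇⁻_eχ̃}(M_χN)`. [cite: Balaban1984PropagatorsI, (1.126)–(1.128) p.38 (mechanism)] -/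
theorem bgrad_comp_smoothCut (hs : mulOp (χt ∘ e.symm) ∘ₗ mulOp χ = mulOp (χt ∘ e.symm)) (hd : mulOp (bgrad n e χt) ∘ₗ mulOp χ = mulOp (bgrad n e χt)) :
    bgrad n e ∘ₗ (mulOp χt ∘ₗ N) = mulOp (χt ∘ e.symm) ∘ₗ (mulOp χ ∘ₗ (bgrad n e ∘ₗ N)) + mulOp (bgrad n e χt) ∘ₗ (mulOp χ ∘ₗ N) := by
  have hsN : mulOp (χt ∘ e.symm) ∘ₗ (mulOp χ ∘ₗ (bgrad n e ∘ₗ N)) = mulOp (χt ∘ e.symm) ∘ₗ (bgrad n e ∘ₗ N) := by rw [← LinearMap.comp_assoc, hs]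
  have hdN : mulOp (bgrad n e χt) ∘ₗ (mulOp χ ∘ₗ N) = mulOp (bgrad n e χt) ∘ₗ N := by rw [← LinearMap.comp_assoc, hd]
  rw [hsN, hdN, ← LinearMap.comp_assoc, bgrad_comp_mulOp, LinearMap.add_comp, LinearMap.comp_assoc]

omit n e in
/-- OUTPUT CUT-OFF OF THE SMOOTH-CUT CUBE: `χχ̃ = χ̃` ⟹ `M_χ∘(M_χ̃N) = M_χ̃N` (file 23's `hGχ` at `G₀ := M_χ̃N`). [folklore] -/
theorem smoothCut_out (hχ : mulOp χ ∘ₗ mulOp χt = mulOp χt) : mulOp χ ∘ₗ (mulOp χt ∘ₗ N) = mulOp χt ∘ₗ N := by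
  rw [← LinearMap.comp_assoc, hχ]

/-- OUTPUT CUT-OFF OF THE FORWARD DERIVED PIECE: `M_χ∘(∇⁺(M_χ̃N)) = ∇⁺(M_χ̃N)` when, besides §1's insertions, `χ(χ̃∘e) = χ̃∘e` and `χ∇⁺χ̃ = ∇⁺χ̃` (file 25's `hχ`∕w4's `hDχ`). [folklore] -/
theorem fgrad_smoothCut_out (hs : mulOp (χt ∘ e) ∘ₗ mulOp χ = mulOp (χt ∘ e)) (hd : mulOp (fgrad n e χt) ∘ₗ mulOp χ = mulOp (fgrad n e χt))
    (hs' : mulOp χ ∘ₗ mulOp (χt ∘ e) = mulOp (χt ∘ e)) (hd' : mulOp χ ∘ₗ mulOp (fgrad n e χt) = mulOp (fgrad n e χt)) :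
    mulOp χ ∘ₗ (fgrad n e ∘ₗ (mulOp χt ∘ₗ N)) = fgrad n e ∘ₗ (mulOp χt ∘ₗ N) := by
  rw [fgrad_comp_smoothCut n e hs hd, LinearMap.comp_add]
  congr 1
  · rw [← LinearMap.comp_assoc _ (mulOp (χt ∘ e)) (mulOp χ), hs']
  · rw [← LinearMap.comp_assoc _ (mulOp (fgrad n e χt)) (mulOp χ), hd']

/-- OUTPUT CUT-OFF OF THE BACKWARD DERIVED PIECE. [folklore] -/
theorem bgrad_smoothCut_out (hs : mulOp (χt ∘ e.symm) ∘ₗ mulOp χ = mulOp (χt ∘ e.symm)) (hd : mulOp (bgrad n e χt) ∘ₗ mulOp χ = mulOp (bgrad n e χt))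
    (hs' : mulOp χ ∘ₗ mulOp (χt ∘ e.symm) = mulOp (χt ∘ e.symm)) (hd' : mulOp χ ∘ₗ mulOp (bgrad n e χt) = mulOp (bgrad n e χt)) :
    mulOp χ ∘ₗ (bgrad n e ∘ₗ (mulOp χt ∘ₗ N)) = bgrad n e ∘ₗ (mulOp χt ∘ₗ N) := by
  rw [bgrad_comp_smoothCut n e hs hd, LinearMap.comp_add]
  congr 1
  · rw [← LinearMap.comp_assoc _ (mulOp (χt ∘ e.symm)) (mulOp χ), hs']
  · rw [← LinearMap.comp_assoc _ (mulOp (bgrad n e χt)) (mulOp χ), hd']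

omit n e in
/-- INPUT CUT-OFF IS INHERITED: `N = NM_ψ` ⟹ `(M_χ̃N)M_ψ = M_χ̃N` (file 23's `hGψ`). [folklore] -/
theorem smoothCut_in {ψ : Y → ℝ} (hNψ : N ∘ₗ mulOp ψ = N) : (mulOp χt ∘ₗ N) ∘ₗ mulOp ψ = mulOp χt ∘ₗ N := by
  rw [LinearMap.comp_assoc, hNψ]

end Algebra

/-! ## §2 Two-sided letters of the smooth-cut cube and its derived pieces from the cut rows -/

section Rows

variable {Y : Type} [Fintype Y] {g : B6.Geometry} (blk : Y → g.Site) (n : ℝ) (e : Y ≃ Y) {N : (Y → ℝ) →ₗ[ℝ] (Y → ℝ)} {χ χt : Y → ℝ} {S : Set g.Site} {β β₁ ct δ : ℝ}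

omit n e in
/-- ★★ **THE SMOOTH-CUT CUBE's LETTER**: `M_χN ≤ 1_S1_S·βe^{−δd}`, `|χ̃| ≤ 1`, `χ̃χ = χ̃` ⟹ `M_χ̃N ≤ 1_S1_S·βe^{−δd}` (file 23's `hG` at `G₀ := M_χ̃N`). [cite: Balaban1984PropagatorsII, (2.38) p.229, (2.133) p.247 (shapes)] -/
theorem hasMaj_smoothCut (hχt : ∀ y, |χt y| ≤ 1) (hsub : mulOp χt ∘ₗ mulOp χ = mulOp χt)
    (hcut : HasMaj (BlockNorm.ofBlocks g blk) (BlockNorm.ofBlocks g blk) (mulOp χ ∘ₗ N) (fun y y' => ind S y * ind S y' * (β * Real.exp (-(δ * g.dist y y'))))) :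
    HasMaj (BlockNorm.ofBlocks g blk) (BlockNorm.ofBlocks g blk) (mulOp χt ∘ₗ N) (fun y y' => ind S y * ind S y' * (β * Real.exp (-(δ * g.dist y y')))) := by
  rw [mulOp_comp_smoothCut hsub]
  refine (hasMaj_mulOp_comp_loc blk zero_le_one hχt hcut).mono fun y y' => le_of_eq ?_
  ring

/-- ★★ **THE FORWARD DERIVED PIECE's LETTER**: cut rows `M_χ∇⁺N ≤ 1_S1_S·β₁e^{−δd}`, `M_χN ≤ 1_S1_S·βe^{−δd}`, bump letters `|χ̃∘e| ≤ 1`, `|∇⁺χ̃| ≤ c̃`, and §1's insertions ⟹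
`∇⁺(M_χ̃N) ≤ 1_S1_S·(β₁ + c̃β)e^{−δd}` (file 23's `hD` for the forward pieces). [cite: Balaban1984PropagatorsII, (2.38) p.229 (bump letters: shape), (2.133)–(2.134) p.247] -/
theorem hasMaj_fgrad_smoothCut (hct : 0 ≤ ct) (hχte : ∀ y, |(χt ∘ e) y| ≤ 1) (hdχt : ∀ y, |fgrad n e χt y| ≤ ct)
    (hs : mulOp (χt ∘ e) ∘ₗ mulOp χ = mulOp (χt ∘ e)) (hd : mulOp (fgrad n e χt) ∘ₗ mulOp χ = mulOp (fgrad n e χt))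
    (hcut : HasMaj (BlockNorm.ofBlocks g blk) (BlockNorm.ofBlocks g blk) (mulOp χ ∘ₗ N) (fun y y' => ind S y * ind S y' * (β * Real.exp (-(δ * g.dist y y')))))
    (hcutD : HasMaj (BlockNorm.ofBlocks g blk) (BlockNorm.ofBlocks g blk) (mulOp χ ∘ₗ (fgrad n e ∘ₗ N)) (fun y y' => ind S y * ind S y' * (β₁ * Real.exp (-(δ * g.dist y y'))))) :
    HasMaj (BlockNorm.ofBlocks g blk) (BlockNorm.ofBlocks g blk) (fgrad n e ∘ₗ (mulOp χt ∘ₗ N))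
      (fun y y' => ind S y * ind S y' * ((β₁ + ct * β) * Real.exp (-(δ * g.dist y y')))) := by
  rw [fgrad_comp_smoothCut n e hs hd]
  have t1 := hasMaj_mulOp_comp_loc blk zero_le_one hχte hcutD
  have t2 := hasMaj_mulOp_comp_loc blk hct hdχt hcut
  refine (t1.add t2).mono fun y y' => le_of_eq ?_
  ring

/-- ★★ **THE BACKWARD DERIVED PIECE's LETTER**: `∇⁻(M_χ̃N) ≤ 1_S1_S·(β₁ + c̃β)e^{−δd}`. [cite: Balaban1984PropagatorsII, (2.38) p.229, (2.133)–(2.134) p.247 (shapes)] -/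
theorem hasMaj_bgrad_smoothCut (hct : 0 ≤ ct) (hχte : ∀ y, |(χt ∘ e.symm) y| ≤ 1) (hdχt : ∀ y, |bgrad n e χt y| ≤ ct)
    (hs : mulOp (χt ∘ e.symm) ∘ₗ mulOp χ = mulOp (χt ∘ e.symm)) (hd : mulOp (bgrad n e χt) ∘ₗ mulOp χ = mulOp (bgrad n e χt))
    (hcut : HasMaj (BlockNorm.ofBlocks g blk) (BlockNorm.ofBlocks g blk) (mulOp χ ∘ₗ N) (fun y y' => ind S y * ind S y' * (β * Real.exp (-(δ * g.dist y y')))))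
    (hcutD : HasMaj (BlockNorm.ofBlocks g blk) (BlockNorm.ofBlocks g blk) (mulOp χ ∘ₗ (bgrad n e ∘ₗ N)) (fun y y' => ind S y * ind S y' * (β₁ * Real.exp (-(δ * g.dist y y'))))) :
    HasMaj (BlockNorm.ofBlocks g blk) (BlockNorm.ofBlocks g blk) (bgrad n e ∘ₗ (mulOp χt ∘ₗ N))
      (fun y y' => ind S y * ind S y' * ((β₁ + ct * β) * Real.exp (-(δ * g.dist y y')))) := by
  rw [bgrad_comp_smoothCut n e hs hd]
  have t1 := hasMaj_mulOp_comp_loc blk zero_le_one hχte hcutD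
  have t2 := hasMaj_mulOp_comp_loc blk hct hdχt hcut
  refine (t1.add t2).mono fun y y' => le_of_eq ?_
  ring

end Rows

/-! ## §3 Two-grid defects of the smooth-cut cube and its derived pieces -/

section Defects

variable {Y Y' : Type} [Fintype Y] [Fintype Y'] {g : B6.Geometry} (blk : Y → g.Site) (π : Y' → Y) (n n' : ℝ) (e : Y ≃ Y) (e' : Y' ≃ Y')
  {N : (Y → ℝ) →ₗ[ℝ] (Y → ℝ)} {N' : (Y' → ℝ) →ₗ[ℝ] (Y' → ℝ)} {χ χt : Y → ℝ} {χ' χt' : Y' → ℝ} {S : Set g.Site} {β β₁ ct m₀ m₁ oχ o₁ o₂ δ : ℝ}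

omit n n' e e' in
/-- a bounded multiplier in front of a localized defect keeps the localization: `|a′| ≤ c` ⟹ `M_{a′}∘T ≤ 1_S1_S·(cK)`. [folklore] -/
theorem hasMaj_mulOp_comp_loc₂' {T : (Y → ℝ) →ₗ[ℝ] (Y' → ℝ)} {a' : Y' → ℝ} {c k : ℝ} (hc : 0 ≤ c) (ha : ∀ y', |a' y'| ≤ c)
    (hT : HasMaj (BlockNorm.ofBlocks g blk) (BlockNorm.ofBlocks g (blk ∘ π)) T (fun y y' => ind S y * ind S y' * (k * Real.exp (-(δ * g.dist y y'))))) :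
    HasMaj (BlockNorm.ofBlocks g blk) (BlockNorm.ofBlocks g (blk ∘ π)) (mulOp a' ∘ₗ T) (fun y y' => ind S y * ind S y' * (c * k * Real.exp (-(δ * g.dist y y')))) := by
  refine (hasMaj_diag_comp (blk ∘ π) (m := fun _ => c) (fun _ => hc) (hasMaj_mulOp (blk ∘ π) (fun _ => hc) ha) hT).mono fun y y' => le_of_eq ?_
  ring

omit n n' e e' in
/-- a fit defect `𝔇(M_{a′}, M_a)` (`|a′ − a∘π| ≤ o`) behind a two-sided row keeps the localization: `𝔇(M_{a′}, M_a)∘T ≤ 1_S1_S·(ok)`. [folklore] -/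
theorem hasMaj_idef_mulOp_comp_loc₂ {T : (Y → ℝ) →ₗ[ℝ] (Y → ℝ)} {a : Y → ℝ} {a' : Y' → ℝ} {o k : ℝ} (ho : 0 ≤ o) (hfit : ∀ y', |a' y' - a (π y')| ≤ o)
    (hT : HasMaj (BlockNorm.ofBlocks g blk) (BlockNorm.ofBlocks g blk) T (fun y y' => ind S y * ind S y' * (k * Real.exp (-(δ * g.dist y y'))))) :
    HasMaj (BlockNorm.ofBlocks g blk) (BlockNorm.ofBlocks g (blk ∘ π)) (idef (pull π) (pull π) (mulOp a') (mulOp a) ∘ₗ T)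
      (fun y y' => ind S y * ind S y' * (o * k * Real.exp (-(δ * g.dist y y')))) := by
  have hD := hasMaj_idef_mulOp (g := g) blk π (o := fun _ => o) (fun _ => ho) hfit
  refine (hasMaj_diag_comp blk (m := fun _ => o) (fun _ => ho) hD hT).mono fun y y' => le_of_eq ?_
  ring

omit n n' e e' in
/-- ★★ **THE SMOOTH-CUT CUBE's TWO-GRID DEFECT**: the cut rows' defect `𝔇(M_{χ′}N′, M_χN) ≤ 1_S1_S·m₀e^{−δd}`, the coarse cut row `M_χN ≤ 1_S1_S·βe^{−δd}`, the bump `|χ̃′| ≤ 1` with fit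
`|χ̃′ − χ̃∘π| ≤ o_χ`, insertions at both grids ⟹ `𝔇(M_{χ̃′}N′, M_χ̃N) ≤ 1_S1_S·(m₀ + o_χβ)e^{−δd}` (file 24's `hDG` at `G₀ := M_χ̃N`). [cite: Balaban1985BackgroundPropagators, Thm 3.14 pp.426–427 (difference template); Balaban1984PropagatorsII, (2.133) p.247] -/
theorem hasMaj_idef_smoothCut (hoχ : 0 ≤ oχ) (hχt' : ∀ y', |χt' y'| ≤ 1) (hfit : ∀ y', |χt' y' - χt (π y')| ≤ oχ)
    (hsub : mulOp χt ∘ₗ mulOp χ = mulOp χt) (hsub' : mulOp χt' ∘ₗ mulOp χ' = mulOp χt')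
    (hcut : HasMaj (BlockNorm.ofBlocks g blk) (BlockNorm.ofBlocks g blk) (mulOp χ ∘ₗ N) (fun y y' => ind S y * ind S y' * (β * Real.exp (-(δ * g.dist y y')))))
    (hDcut : HasMaj (BlockNorm.ofBlocks g blk) (BlockNorm.ofBlocks g (blk ∘ π)) (idef (pull π) (pull π) (mulOp χ' ∘ₗ N') (mulOp χ ∘ₗ N))
      (fun y y' => ind S y * ind S y' * (m₀ * Real.exp (-(δ * g.dist y y'))))) :
    HasMaj (BlockNorm.ofBlocks g blk) (BlockNorm.ofBlocks g (blk ∘ π)) (idef (pull π) (pull π) (mulOp χt' ∘ₗ N') (mulOp χt ∘ₗ N))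
      (fun y y' => ind S y * ind S y' * ((m₀ + oχ * β) * Real.exp (-(δ * g.dist y y')))) := by
  rw [mulOp_comp_smoothCut hsub, mulOp_comp_smoothCut hsub', idef_comp (pull π) (pull π) (pull π) (mulOp χt') (mulOp χ' ∘ₗ N') (mulOp χt) (mulOp χ ∘ₗ N)]
  have t1 := hasMaj_mulOp_comp_loc₂' blk π zero_le_one hχt' hDcut
  have t2 := hasMaj_idef_mulOp_comp_loc₂ blk π hoχ hfit hcut
  refine (t1.add t2).mono fun y y' => le_of_eq ?_
  ring

/-- ★★ **THE FORWARD DERIVED PIECE's TWO-GRID DEFECT**: cut-row defects `𝔇(M_{χ′}∇′⁺N′, M_χ∇⁺N) ≤ 1_S1_S·m₁e^{−δd}`, `𝔇(M_{χ′}N′, M_χN) ≤ 1_S1_S·m₀e^{−δd}`, coarse cut rows `β₁, β`, fine bump letters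
`|χ̃′∘e′| ≤ 1`, `|∇′⁺χ̃′| ≤ c̃`, fits `|χ̃′∘e′ − (χ̃∘e)∘π| ≤ o₁`, `|∇′⁺χ̃′ − (∇⁺χ̃)∘π| ≤ o₂`, insertions at both grids ⟹
`𝔇(∇′⁺(M_{χ̃′}N′), ∇⁺(M_χ̃N)) ≤ 1_S1_S·(m₁ + o₁β₁ + c̃m₀ + o₂β)e^{−δd}` (file 24's `hDD` for the forward pieces). [cite: Balaban1985BackgroundPropagators, Thm 3.14 pp.426–427 (template); Balaban1984PropagatorsII, (2.133)–(2.134) p.247] -/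
theorem hasMaj_idef_fgrad_smoothCut (hct : 0 ≤ ct) (ho₁ : 0 ≤ o₁) (ho₂ : 0 ≤ o₂)
    (hχte' : ∀ y', |(χt' ∘ e') y'| ≤ 1) (hdχt' : ∀ y', |fgrad n' e' χt' y'| ≤ ct)
    (hfit₁ : ∀ y', |(χt' ∘ e') y' - (χt ∘ e) (π y')| ≤ o₁) (hfit₂ : ∀ y', |fgrad n' e' χt' y' - fgrad n e χt (π y')| ≤ o₂)
    (hs : mulOp (χt ∘ e) ∘ₗ mulOp χ = mulOp (χt ∘ e)) (hd : mulOp (fgrad n e χt) ∘ₗ mulOp χ = mulOp (fgrad n e χt))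
    (hs' : mulOp (χt' ∘ e') ∘ₗ mulOp χ' = mulOp (χt' ∘ e')) (hd' : mulOp (fgrad n' e' χt') ∘ₗ mulOp χ' = mulOp (fgrad n' e' χt'))
    (hcut : HasMaj (BlockNorm.ofBlocks g blk) (BlockNorm.ofBlocks g blk) (mulOp χ ∘ₗ N) (fun y y' => ind S y * ind S y' * (β * Real.exp (-(δ * g.dist y y')))))
    (hcutD : HasMaj (BlockNorm.ofBlocks g blk) (BlockNorm.ofBlocks g blk) (mulOp χ ∘ₗ (fgrad n e ∘ₗ N)) (fun y y' => ind S y * ind S y' * (β₁ * Real.exp (-(δ * g.dist y y')))))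
    (hDcut : HasMaj (BlockNorm.ofBlocks g blk) (BlockNorm.ofBlocks g (blk ∘ π)) (idef (pull π) (pull π) (mulOp χ' ∘ₗ N') (mulOp χ ∘ₗ N))
      (fun y y' => ind S y * ind S y' * (m₀ * Real.exp (-(δ * g.dist y y')))))
    (hDcutD : HasMaj (BlockNorm.ofBlocks g blk) (BlockNorm.ofBlocks g (blk ∘ π)) (idef (pull π) (pull π) (mulOp χ' ∘ₗ (fgrad n' e' ∘ₗ N')) (mulOp χ ∘ₗ (fgrad n e ∘ₗ N)))
      (fun y y' => ind S y * ind S y' * (m₁ * Real.exp (-(δ * g.dist y y'))))) :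
    HasMaj (BlockNorm.ofBlocks g blk) (BlockNorm.ofBlocks g (blk ∘ π)) (idef (pull π) (pull π) (fgrad n' e' ∘ₗ (mulOp χt' ∘ₗ N')) (fgrad n e ∘ₗ (mulOp χt ∘ₗ N)))
      (fun y y' => ind S y * ind S y' * ((m₁ + o₁ * β₁ + ct * m₀ + o₂ * β) * Real.exp (-(δ * g.dist y y')))) := by
  rw [fgrad_comp_smoothCut n e hs hd, fgrad_comp_smoothCut n' e' hs' hd', idef_add,
    idef_comp (pull π) (pull π) (pull π) (mulOp (χt' ∘ e')) (mulOp χ' ∘ₗ (fgrad n' e' ∘ₗ N')) (mulOp (χt ∘ e)) (mulOp χ ∘ₗ (fgrad n e ∘ₗ N)),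
    idef_comp (pull π) (pull π) (pull π) (mulOp (fgrad n' e' χt')) (mulOp χ' ∘ₗ N') (mulOp (fgrad n e χt)) (mulOp χ ∘ₗ N)]
  have t1 := hasMaj_mulOp_comp_loc₂' blk π zero_le_one hχte' hDcutD
  have t2 := hasMaj_idef_mulOp_comp_loc₂ blk π ho₁ hfit₁ hcutD
  have t3 := hasMaj_mulOp_comp_loc₂' blk π hct hdχt' hDcut
  have t4 := hasMaj_idef_mulOp_comp_loc₂ blk π ho₂ hfit₂ hcut
  refine ((t1.add t2).add (t3.add t4)).mono fun y y' => le_of_eq ?_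
  ring

/-- ★★ **THE BACKWARD DERIVED PIECE's TWO-GRID DEFECT**: `𝔇(∇′⁻(M_{χ̃′}N′), ∇⁻(M_χ̃N)) ≤ 1_S1_S·(m₁ + o₁β₁ + c̃m₀ + o₂β)e^{−δd}`. [cite: Balaban1985BackgroundPropagators, Thm 3.14 pp.426–427 (template); Balaban1984PropagatorsII, (2.133)–(2.134) p.247] -/
theorem hasMaj_idef_bgrad_smoothCut (hct : 0 ≤ ct) (ho₁ : 0 ≤ o₁) (ho₂ : 0 ≤ o₂)
    (hχte' : ∀ y', |(χt' ∘ e'.symm) y'| ≤ 1) (hdχt' : ∀ y', |bgrad n' e' χt' y'| ≤ ct)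
    (hfit₁ : ∀ y', |(χt' ∘ e'.symm) y' - (χt ∘ e.symm) (π y')| ≤ o₁) (hfit₂ : ∀ y', |bgrad n' e' χt' y' - bgrad n e χt (π y')| ≤ o₂)
    (hs : mulOp (χt ∘ e.symm) ∘ₗ mulOp χ = mulOp (χt ∘ e.symm)) (hd : mulOp (bgrad n e χt) ∘ₗ mulOp χ = mulOp (bgrad n e χt))
    (hs' : mulOp (χt' ∘ e'.symm) ∘ₗ mulOp χ' = mulOp (χt' ∘ e'.symm)) (hd' : mulOp (bgrad n' e' χt') ∘ₗ mulOp χ' = mulOp (bgrad n' e' χt'))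
    (hcut : HasMaj (BlockNorm.ofBlocks g blk) (BlockNorm.ofBlocks g blk) (mulOp χ ∘ₗ N) (fun y y' => ind S y * ind S y' * (β * Real.exp (-(δ * g.dist y y')))))
    (hcutD : HasMaj (BlockNorm.ofBlocks g blk) (BlockNorm.ofBlocks g blk) (mulOp χ ∘ₗ (bgrad n e ∘ₗ N)) (fun y y' => ind S y * ind S y' * (β₁ * Real.exp (-(δ * g.dist y y')))))
    (hDcut : HasMaj (BlockNorm.ofBlocks g blk) (BlockNorm.ofBlocks g (blk ∘ π)) (idef (pull π) (pull π) (mulOp χ' ∘ₗ N') (mulOp χ ∘ₗ N))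
      (fun y y' => ind S y * ind S y' * (m₀ * Real.exp (-(δ * g.dist y y')))))
    (hDcutD : HasMaj (BlockNorm.ofBlocks g blk) (BlockNorm.ofBlocks g (blk ∘ π)) (idef (pull π) (pull π) (mulOp χ' ∘ₗ (bgrad n' e' ∘ₗ N')) (mulOp χ ∘ₗ (bgrad n e ∘ₗ N)))
      (fun y y' => ind S y * ind S y' * (m₁ * Real.exp (-(δ * g.dist y y'))))) :
    HasMaj (BlockNorm.ofBlocks g blk) (BlockNorm.ofBlocks g (blk ∘ π)) (idef (pull π) (pull π) (bgrad n' e' ∘ₗ (mulOp χt' ∘ₗ N')) (bgrad n e ∘ₗ (mulOp χt ∘ₗ N)))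
      (fun y y' => ind S y * ind S y' * ((m₁ + o₁ * β₁ + ct * m₀ + o₂ * β) * Real.exp (-(δ * g.dist y y')))) := by
  rw [bgrad_comp_smoothCut n e hs hd, bgrad_comp_smoothCut n' e' hs' hd', idef_add,
    idef_comp (pull π) (pull π) (pull π) (mulOp (χt' ∘ e'.symm)) (mulOp χ' ∘ₗ (bgrad n' e' ∘ₗ N')) (mulOp (χt ∘ e.symm)) (mulOp χ ∘ₗ (bgrad n e ∘ₗ N)),
    idef_comp (pull π) (pull π) (pull π) (mulOp (bgrad n' e' χt')) (mulOp χ' ∘ₗ N') (mulOp (bgrad n e χt)) (mulOp χ ∘ₗ N)]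
  have t1 := hasMaj_mulOp_comp_loc₂' blk π zero_le_one hχte' hDcutD
  have t2 := hasMaj_idef_mulOp_comp_loc₂ blk π ho₁ hfit₁ hcutD
  have t3 := hasMaj_mulOp_comp_loc₂' blk π hct hdχt' hDcut
  have t4 := hasMaj_idef_mulOp_comp_loc₂ blk π ho₂ hfit₂ hcut
  refine ((t1.add t2).add (t3.add t4)).mono fun y y' => le_of_eq ?_
  ring

end Defects

end Summit.QuantumFields.YangMills.BalabanUVNodes.N15.CurvedSpecies

end
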